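import Summits.BirchSwinnertonDyer.Rank1Residual.X11a.ChainHeightFree
import HarnessLib

/-!
# Class X11a: the chain of record BY SPLIT TYPE — 12 named facts at a non-split prime, 13 at a
# split prime (cell `b2b-bsdres`, unit `b2b-bsdres-x11a`, gen 18)

HONEST FRAMING (run/shared/lean/b2b/bsd-rank1-residual/, verbatim in every file): the goal of the
cell is to DELETE the COMBINATION-SHAPED residual classes of the Birch–Swinnerton-Dyer formula for
ALL analytic-rank `≤ 1` elliptic curves over `ℚ` — "full BSD formula for every rank `≤ 1` curve in
class `C`" assembled STRICTLY from published theorems — so that the rank-`≤ 1` remainder becomes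
exactly the CONSTRUCTION-SHAPED classes, which are TYPED (missing-input `Prop`s), NOT attempted.
This is not "finishing BSD". Research route; NO CLAIM BEYOND STATED CLASSES. No label change is
made by this file (cell lead / referee).

`X11a/ChainHeightFree.lean` (`forall_bsdp_of_namedFacts_mtt_heightFree`) closes `BSD(E,p)` on
X11a ∩ {`p ≥ 5`, `ρ̄_{E,p}` surjective} from 14 named published facts + the per-pair certificate.
Two of the 14 are used on one split type only:
* Greenberg–Stevens (`hGS : greenberg_stevens`, the trivial-zero formula) quantifies over a Tate
  parameter datum `Dq : TateParameterData W p`, whose field `split` records SPLIT multiplicative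
  reduction — so at a NON-split prime the statement `greenberg_stevens (W := W) (p := p)` is
  vacuously TRUE (`greenberg_stevens_of_not_split`, proved here), and the binder disappears;
* Stein–Wuthrich Thm. 6.1 comes in two named facts, `thm61_splitMultiplicative` (`hJs`) and
  `thm61_nonsplitMultiplicative` (`hJn`); each pair needs exactly one.
Hence, per pair, the published inputs are **12 named facts at a non-split `p`** (Hida member; EPW
Thm 3.1.1 / Thm 1 / Thm 5.1.3; Wan Thm 4 rational; Deligne–Serre 6.1; Hida/Wiles 3.26; Kato–Wuthrich
A32; Stein–Wuthrich Thm 6.1 non-split; GZK; modularity ×2) and **13 at a split `p`** (the same with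
Stein–Wuthrich Thm 6.1 split, plus Greenberg–Stevens) — this file records both class-level forms
(`forall_bsdp_of_namedFacts_mtt_heightFree_of_nonsplit` / `_of_split`) through one-branch versions
of the rank-`0` junction (`X2.bsdp_of_mazurMainConjectureAt_of_analyticRank_eq_zero_heightFree_{nonsplit,split}`,
adapted from `X11a/RankZeroHeightFree.lean`). For the lane's per-pair booking lines ("PUB (…) +
certificate") this is the exact fact list by split type; nothing else changes.

References: as in `X11a/ChainHeightFree.lean`; Greenberg–Stevens 1993 / Kobayashi 2006 Cor. 4.2
[Kobayashi2006DocMath]; Stein–Wuthrich 2013 Thm. 6.1 [SteinWuthrich2013].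
-/

noncomputable section

open scoped Classical MatrixGroups ModularForm

open CongruenceSubgroup WeierstrassCurve Literature.NumberTheory.EllipticCurves
  Literature.NumberTheory.EllipticCurves.ModularForms
  Literature.NumberTheory.EllipticCurves.Rank1Residual
  Literature.NumberTheory.EllipticCurves.Rank1Residual.Typed
  Literature.NumberTheory.EllipticCurves.Wuthrich2014
  Literature.NumberTheory.EllipticCurves.SteinWuthrich2013
  Literature.NumberTheory.EllipticCurves.GreenbergVatsal2000
  Literature.NumberTheory.EllipticCurves.EmertonPollackWeston2006
  Summit.BirchSwinnertonDyer.Rank1Residual.X1.MuLambda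
  Summit.BirchSwinnertonDyer.Rank1Residual.X11a.LambdaNorm
  Summit.BirchSwinnertonDyer.Rank1Residual.RankZeroHeightFree

set_option autoImplicit false

namespace Summit.BirchSwinnertonDyer.Rank1Residual.RankZeroHeightFree

/-! ### Greenberg–Stevens is vacuous at a non-split prime -/

/-- **At a prime where `E` is NOT split multiplicative, the tree's Greenberg–Stevens statement
`greenberg_stevens (W := W) (p := p)` holds vacuously**: it quantifies over
`Dq : TateParameterData W p`, and `Dq.split : W.HasSplitMultiplicativeReductionAtPrime p`.
(Bookkeeping only: the trivial-zero formula is a statement about split primes.) [folklore] -/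
theorem greenberg_stevens_of_not_split (W : WeierstrassCurve ℚ) [W.IsElliptic]
    [W.IsGloballyMinimal] (p : ℕ) [Fact p.Prime]
    (hns : ¬ W.HasSplitMultiplicativeReductionAtPrime p) :
    greenberg_stevens (W := W) (p := p) :=
  fun Dq => absurd Dq.split hns

/-! ### The rank-`0` junction, one branch at a time -/

/-- **Rank `0`, NON-split multiplicative `p ≠ 2`: Mazur's main conjecture at `(E,p)` ⇒ `BSD(E,p)`
from Stein–Wuthrich Thm. 6.1 NON-SPLIT (`hJn`), GZK and modularity only** (no Greenberg–Stevens, no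
split Thm. 6.1, no height-existence fact) — the non-split branch of
`X2.bsdp_of_mazurMainConjectureAt_of_analyticRank_eq_zero_heightFree`.
-- adapted from Summits/BirchSwinnertonDyer/Rank1Residual/X11a/RankZeroHeightFree.lean
[cite: SteinWuthrich2013, Thm. 6.1 (p. 20) and §4.2 (p. 15)] [cite: Miller2011LMS, Def. 1.1 and §1] -/
theorem _root_.Summit.BirchSwinnertonDyer.Rank1Residual.X2.bsdp_of_mazurMainConjectureAt_of_analyticRank_eq_zero_heightFree_nonsplit
    (hJn : thm61_nonsplitMultiplicative)
    (hGZK : rank_eq_analyticRank_of_analyticRank_le_one) (hmod : hasEntireLFunction_rat)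
    (hpar : nonempty_modularParametrizationData)
    (W : WeierstrassCurve ℚ) [W.IsElliptic] [W.IsGloballyMinimal] (p : ℕ) [Fact p.Prime]
    (hp : p ≠ 2) (hmult : W.HasMultiplicativeReductionAtPrime p)
    (hns : ¬ W.HasSplitMultiplicativeReductionAtPrime p) (hr : W.analyticRank = 0)
    (hMC : X2.MazurMainConjectureAt W p) : BSDp W p := by
  obtain ⟨κ, hκ, γ, hγ, hγ'⟩ := exists_isCyclotomic_isTopGenerator_isCyclotomicVariable_holds p
  obtain ⟨D⟩ := W.nonempty_selmerDualData_holds κ γ hγ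
  haveI : NeZero (W.conductorNorm ℤ) := ⟨(W.conductorNorm_pos_holds).ne'⟩
  obtain ⟨Dm⟩ := hpar W
  obtain ⟨ϖ, hϖpos, hϖ, -⟩ := Dm.exists_rat_mul_realPeriodRat_eq_plusPeriod
  obtain ⟨hX, g, hchar, -, hnsp⟩ := hMC κ γ hκ hγ hγ' Dm.f Dm.isNewformOf D ϖ hϖ
  obtain ⟨L, hL⟩ := exists_isMultPAdicLFunctionOf_neg_one_of_nonsplit Dm.isNewformOf hmult hns
  obtain ⟨q, ⟨hq0, hq1, hqj⟩, -⟩ := existsUnique_tateJ_eq_of_one_lt_norm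
    (one_lt_norm_j_of_hasMultiplicativeReductionAtPrime (W := W) (p := p) hmult)
  obtain ⟨w, hw⟩ := hnsp hns L hL
  exact bsdp_of_multCharIdeal_nonsplit_rankZero_heightFree hJn hGZK hmod W p hp hr hmult hns hq0 hq1
    hqj hκ hγ hγ' Dm.isNewformOf D ϖ hϖpos.ne' hϖ L hL ⟨hX, g, w, hchar, hw⟩

/-- **Rank `0`, SPLIT multiplicative `p ≠ 2`: Mazur's main conjecture at `(E,p)` ⇒ `BSD(E,p)` from
Stein–Wuthrich Thm. 6.1 SPLIT (`hJs`), Greenberg–Stevens at the pair (`hGS`), GZK and modularity**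
(no non-split Thm. 6.1, no height-existence fact; `𝓛_p ≠ 0` is the tree theorem
`LInvariant_ne_zero_holds`) — the split branch of the junction.
-- adapted from Summits/BirchSwinnertonDyer/Rank1Residual/X11a/RankZeroHeightFree.lean
[cite: SteinWuthrich2013, Thm. 6.1 (p. 20) and §4.2 (p. 16)] [cite: Kobayashi2006DocMath, Cor. 4.2 (p. 575)]
[cite: Miller2011LMS, Def. 1.1 and §1] -/
theorem _root_.Summit.BirchSwinnertonDyer.Rank1Residual.X2.bsdp_of_mazurMainConjectureAt_of_analyticRank_eq_zero_heightFree_split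
    (hJs : thm61_splitMultiplicative)
    (hGZK : rank_eq_analyticRank_of_analyticRank_le_one) (hmod : hasEntireLFunction_rat)
    (hpar : nonempty_modularParametrizationData)
    (W : WeierstrassCurve ℚ) [W.IsElliptic] [W.IsGloballyMinimal] (p : ℕ) [Fact p.Prime]
    (hGS : greenberg_stevens (W := W) (p := p))
    (hp : p ≠ 2) (hsplit : W.HasSplitMultiplicativeReductionAtPrime p) (hr : W.analyticRank = 0)
    (hMC : X2.MazurMainConjectureAt W p) : BSDp W p := by
  obtain ⟨κ, hκ, γ, hγ, hγ'⟩ := exists_isCyclotomic_isTopGenerator_isCyclotomicVariable_holds p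
  obtain ⟨D⟩ := W.nonempty_selmerDualData_holds κ γ hγ
  haveI : NeZero (W.conductorNorm ℤ) := ⟨(W.conductorNorm_pos_holds).ne'⟩
  obtain ⟨Dm⟩ := hpar W
  obtain ⟨ϖ, hϖpos, hϖ, -⟩ := Dm.exists_rat_mul_realPeriodRat_eq_plusPeriod
  obtain ⟨hX, g, hchar, hsp, -⟩ := hMC κ γ hκ hγ hγ' Dm.f Dm.isNewformOf D ϖ hϖ
  obtain ⟨L, hL⟩ := exists_isSplitMultPAdicLFunctionOf hsplit Dm.isNewformOf
  obtain ⟨Dq⟩ := (nonempty_tateParameterData_iff_holds (W := W) (p := p)).mpr hsplit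
  obtain ⟨w, hw⟩ := hsp hsplit L hL
  exact bsdp_of_multCharIdeal_split_rankZero_heightFree hJs hGZK hmod W p hGS
    LInvariant_ne_zero_holds hp hr Dq hκ hγ hγ' Dm.isNewformOf D ϖ hϖpos.ne' hϖ L hL
    ⟨hX, g, w, hchar, hw⟩

end Summit.BirchSwinnertonDyer.Rank1Residual.RankZeroHeightFree

namespace Summit.BirchSwinnertonDyer.Rank1Residual.X11a

open Chain

/-! ### Class level by split type -/

/-- **X11a ∩ {`p ≥ 5`, `ρ̄_{E,p}` surjective, `p` NON-split}: `BSD(E,p)` ⇐ 12 NAMED PUBLISHED FACTS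
+ the per-pair certificate `μ^an(E,p) = 0`.** The 12: Hida's member (`hHida`), EPW Thm 3.1.1 / 1 /
5.1.3 (`h311`, `hT1a`, `hT1b`), Wan Thm 4 rational (`hT2`), Deligne–Serre 6.1 (`h61`), Hida/Wiles
3.26 (`h326`), Kato–Wuthrich A32 (`hKato`), Stein–Wuthrich Thm 6.1 NON-split (`hJn`), GZK (`hGZK`),
modularity (`hmod`, `hpar`). Greenberg–Stevens is vacuous here (`greenberg_stevens_of_not_split`);
the existence inputs (E1)–(E3) are the harvest-2 theorems as in `forall_bsdp_of_namedFacts`; the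
MTT existence fact is the tree theorem `exists_isCycPAdicLFunctionWeightK_holds`. No label change.
[cite: EmertonPollackWeston2006, Thm. 1, Thm. 3.1.1, Thm. 5.1.3, §3.1] [cite: Wan2015, Thm. 4]
[cite: SteinWuthrich2013, Thm. 6.1 (p. 20) and §4.2 (p. 15)]
[cite: Wuthrich2014, Thm. 3 (p. 382) and Cor. 19 proof (p. 399)] -/
theorem forall_bsdp_of_namedFacts_mtt_heightFree_of_nonsplit
    (hHida : hida_exists_congruent_ordinary_newform_of_multiplicative)
    (h311 : thm311_cotorsion_weightK_member) (hT1a : thm1_muAlg_of_weightK_member)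
    (hT2 : Wan2015.thm4_rational_weightK_member) (hT1b : thm513_transfer_from_weightK_member)
    (h61 : DeligneSerre1974.thm61_exists_adicGaloisRep) (h326 : Hida2000_thm326_ordinary)
    (hKato : kato_charIdeal_dvd_multiplicative_of_surjective)
    (hJn : thm61_nonsplitMultiplicative)
    (hGZK : rank_eq_analyticRank_of_analyticRank_le_one) (hmod : hasEntireLFunction_rat)
    (hpar : nonempty_modularParametrizationData) :
    ∀ (W : WeierstrassCurve ℚ) [W.IsElliptic] [W.IsGloballyMinimal] (p : ℕ) [Fact p.Prime],
      ClassX11a W p → 5 ≤ p → Surj W p → ¬ W.HasSplitMultiplicativeReductionAtPrime p →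
        MuAnZeroAt W p → BSDp W p := by
  intro W _ _ p _ hX hp hsurj hns hμ
  haveI : NeZero (W.conductorNorm ℤ / p) := neZero_conductorNorm_div W p hX.2.2.1
  haveI : NeZero p := ⟨(Fact.out : p.Prime).ne_zero⟩
  have hmult : W.HasMultiplicativeReductionAtPrime p := hX.2.2.1
  have hirr : W.HasIrreducibleModPGaloisRep p :=
    hasIrreducibleModPGaloisRep_of_hasSurjectiveModNGaloisRep W p hsurj
  have hGS : greenberg_stevens (W := W) (p := p) :=
    RankZeroHeightFree.greenberg_stevens_of_not_split W p hns
  have hinv : InvariantsMatchAt W p :=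
    invariantsMatchAt_of_invariantsAt_normLam W p
      (invariantsAt_normLam_of_facts W p hHida exists_isCycPAdicLFunctionWeightK_holds h311 hT1a hT2
        hT1b hKato hpar
        (fun g ι hmem =>
          exists_ordinaryPadicData_weightK_member_of_thm61_of_thm326 h61 h326 W p hp hmult hirr g ι
            hmem)
        (fun g ι hmem 𝔇 κ γ hκ hγ =>
          GreenbergSelmer.exists_dualData_weightK_member_unconditional W p hp hmult hirr g ι hmem 𝔇
            κ γ hκ hγ)
        (fun g ι hmem 𝔇 κ γ hκ hγ D hfin htors =>
          (charIdeal_isPrincipal_weightK_member_unconditional W p hp hmult hirr g ι hmem 𝔇 κ γ hκ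
            hγ D hfin htors).principal)
        hp hmult hsurj hμ)
  exact X2.bsdp_of_mazurMainConjectureAt_of_analyticRank_eq_zero_heightFree_nonsplit hJn hGZK hmod
    hpar W p (by omega) hmult hns hX.1
    (mazurMainConjectureAt_of_invariantsMatchAt hKato hmod W p hGS hp hmult hsurj hX.1 hinv)

/-- **X11a ∩ {`p ≥ 5`, `ρ̄_{E,p}` surjective, `p` SPLIT}: `BSD(E,p)` ⇐ 13 NAMED PUBLISHED FACTS +
the per-pair certificate** — the 12 of the non-split case with Stein–Wuthrich Thm 6.1 SPLIT
(`hJs`) in place of non-split, plus Greenberg–Stevens (`hGS`, needed: the trivial zero).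
No label change. [cite: EmertonPollackWeston2006, Thm. 1, Thm. 3.1.1, Thm. 5.1.3, §3.1]
[cite: Wan2015, Thm. 4] [cite: SteinWuthrich2013, Thm. 6.1 (p. 20) and §4.2 (p. 16)]
[cite: Kobayashi2006DocMath, Cor. 4.2 (p. 575)] [cite: Wuthrich2014, Thm. 3 (p. 382) and Cor. 19 proof (p. 399)] -/
theorem forall_bsdp_of_namedFacts_mtt_heightFree_of_split
    (hHida : hida_exists_congruent_ordinary_newform_of_multiplicative)
    (h311 : thm311_cotorsion_weightK_member) (hT1a : thm1_muAlg_of_weightK_member)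
    (hT2 : Wan2015.thm4_rational_weightK_member) (hT1b : thm513_transfer_from_weightK_member)
    (h61 : DeligneSerre1974.thm61_exists_adicGaloisRep) (h326 : Hida2000_thm326_ordinary)
    (hKato : kato_charIdeal_dvd_multiplicative_of_surjective)
    (hJs : thm61_splitMultiplicative)
    (hGZK : rank_eq_analyticRank_of_analyticRank_le_one) (hmod : hasEntireLFunction_rat)
    (hpar : nonempty_modularParametrizationData)
    (hGS : ∀ (W : WeierstrassCurve ℚ) [W.IsElliptic] [W.IsGloballyMinimal] (p : ℕ) [Fact p.Prime],
      greenberg_stevens (W := W) (p := p)) :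
    ∀ (W : WeierstrassCurve ℚ) [W.IsElliptic] [W.IsGloballyMinimal] (p : ℕ) [Fact p.Prime],
      ClassX11a W p → 5 ≤ p → Surj W p → W.HasSplitMultiplicativeReductionAtPrime p →
        MuAnZeroAt W p → BSDp W p := by
  intro W _ _ p _ hX hp hsurj hsplit hμ
  haveI : NeZero (W.conductorNorm ℤ / p) := neZero_conductorNorm_div W p hX.2.2.1
  haveI : NeZero p := ⟨(Fact.out : p.Prime).ne_zero⟩
  have hmult : W.HasMultiplicativeReductionAtPrime p := hX.2.2.1
  have hirr : W.HasIrreducibleModPGaloisRep p :=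
    hasIrreducibleModPGaloisRep_of_hasSurjectiveModNGaloisRep W p hsurj
  have hinv : InvariantsMatchAt W p :=
    invariantsMatchAt_of_invariantsAt_normLam W p
      (invariantsAt_normLam_of_facts W p hHida exists_isCycPAdicLFunctionWeightK_holds h311 hT1a hT2
        hT1b hKato hpar
        (fun g ι hmem =>
          exists_ordinaryPadicData_weightK_member_of_thm61_of_thm326 h61 h326 W p hp hmult hirr g ι
            hmem)
        (fun g ι hmem 𝔇 κ γ hκ hγ =>
          GreenbergSelmer.exists_dualData_weightK_member_unconditional W p hp hmult hirr g ι hmem 𝔇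
            κ γ hκ hγ)
        (fun g ι hmem 𝔇 κ γ hκ hγ D hfin htors =>
          (charIdeal_isPrincipal_weightK_member_unconditional W p hp hmult hirr g ι hmem 𝔇 κ γ hκ
            hγ D hfin htors).principal)
        hp hmult hsurj hμ)
  exact X2.bsdp_of_mazurMainConjectureAt_of_analyticRank_eq_zero_heightFree_split hJs hGZK hmod hpar
    W p (hGS W p) (by omega) hsplit hX.1
    (mazurMainConjectureAt_of_invariantsMatchAt hKato hmod W p (hGS W p) hp hmult hsurj hX.1 hinv)

end Summit.BirchSwinnertonDyer.Rank1Residual.X11a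

end
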